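import Summits.Ventures.PercRepro.RankLevelSetHallEqSplit

/-!
# PercRepro — THE `d`-TILTED SPLIT (R10): LOADS ≤ 1 AND THE TRANSFER TO THE UP-HALL FORM
(p4, gen 38; paper proofs/P4-CAP-KERNEL.md Addendum 3; C-044, UP form, tight layer `#E = p + q`, any `k`)

After the refutation of every `d`-blind rule (kernel A; equal split, flat-LYM and capped LYM — all three coincide on
`M₀ = U_{q,q+d} ⊕ U_{q−d+k, q−d+k}` and fail there from `q = 72`), the candidate of record is the **`d`-tilted split**: inside a
`Y`-set `S` the members `Z' ⊆ S` share the unit in proportion to `θ(Z') = 1 + τ · d(Z')/q`, `d(Z') = #(cl Z' ∖ Z')`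
(`tiltTheta`, `tiltWeight`; `τ = 0` is the equal split).  THIS FILE: for `τ ≥ 0` the weight is non-negative, supported on `Z ⊆ S`,
and every `Y`-set is loaded at most `1` (`tiltWeight_load_le_one`, exactly `1` when `S` contains a member).  `TiltRecv M p q τ`
(a `Prop`, NOT asserted: every member receives at least `Φ(p,q)`) gives the UP-Hall condition for every family
(`hallUp_of_tilt`).  Evidence (p4 g38, exact): on `M₀(q, d, k)` with `τ = 1` every member type receives `≥ Φ` for all `d` at
`(q,k) ∈ {(20,8), (40,14), (60,10), (80,14)}` and at the caps `c ∈ {3,5,6,7,10}` up to `q = 150` (where the equal split fails);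
min receipt/Φ `≥ 1` on the `n ≤ 11` census, the fat-class and kernel-A-killer families and direct sums of uniform matroids
(`τ ∈ {1/2, 1, 2}`); adversarial climbs kit j335461.  NOT proved: the denominator `Σ_{Z' ⊆ S} θ(Z')` has no `Z`-local bound.

* `tiltTheta`, `tiltWeight`;
* `tiltTheta_pos`, `tiltWeight_nonneg`, `subset_of_tiltWeight_ne_zero`, **`tiltWeight_load_le_one`**;
* `TiltRecv`, **`hallUp_of_tilt`**.
Axioms: standard.
-/

namespace PercRepro

open Set Matroid Finset

variable {α : Type} (M : Matroid α) [M.Finite]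

/-- `θ(Z) = 1 + τ · d(Z)/q`, `d(Z) = #(cl Z ∖ Z)`. -/
noncomputable def tiltTheta (q : ℕ) (τ : ℚ) (Z : Set α) : ℚ :=
  1 + τ * (((M.closure Z \ Z).ncard : ℕ) : ℚ) / (q : ℚ)

/-- **The `d`-tilted weight** of the member `Z` at the `Y`-set `S`: `θ(Z) / Σ_{Z' ⊆ S} θ(Z')` when `Z ⊆ S`, `0` otherwise. -/
noncomputable def tiltWeight (p q : ℕ) (τ : ℚ) (Z S : Set α) : ℚ := by
  classical
  exact if Z ∈ cellMembers M p q ∧ Z ⊆ S ∧ S ∈ cellY M p q then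
    tiltTheta M q τ Z / ∑ Z' ∈ (eqMembers_finite M p q S).toFinset, tiltTheta M q τ Z' else 0

omit [M.Finite] in
/-- `θ(Z) ≥ 1 > 0` for `τ ≥ 0`. -/
theorem tiltTheta_pos (q : ℕ) {τ : ℚ} (hτ : 0 ≤ τ) (Z : Set α) : 0 < tiltTheta M q τ Z := by
  unfold tiltTheta
  have : 0 ≤ τ * (((M.closure Z \ Z).ncard : ℕ) : ℚ) / (q : ℚ) := by positivity
  linarith

/-- The weight is non-negative for `τ ≥ 0`. -/
theorem tiltWeight_nonneg (p q : ℕ) {τ : ℚ} (hτ : 0 ≤ τ) (Z S : Set α) : 0 ≤ tiltWeight M p q τ Z S := by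
  classical
  unfold tiltWeight
  split_ifs
  · exact div_nonneg (tiltTheta_pos M q hτ Z).le (Finset.sum_nonneg (fun Z' _ => (tiltTheta_pos M q hτ Z').le))
  · exact le_rfl

/-- The weight is supported on the pairs `Z ⊆ S`. -/
theorem subset_of_tiltWeight_ne_zero (p q : ℕ) (τ : ℚ) (Z S : Set α) (h : tiltWeight M p q τ Z S ≠ 0) : Z ⊆ S := by
  classical
  by_contra hZS
  apply h
  unfold tiltWeight
  rw [if_neg (fun hc => hZS hc.2.1)]

/-- **Every `Y`-set is loaded at most `1`** (exactly `1` when it contains a member): the shares are proportional to `θ`. -/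
theorem tiltWeight_load_le_one (p q : ℕ) {τ : ℚ} (hτ : 0 ≤ τ) {S : Set α} (hS : S ∈ cellY M p q) :
    ∑ Z ∈ (cellMembers_finite M p q).toFinset, tiltWeight M p q τ Z S ≤ 1 := by
  classical
  set Mf : Finset (Set α) := (cellMembers_finite M p q).toFinset with hMf
  have hmemM : ∀ Z, Z ∈ Mf ↔ Z ∈ cellMembers M p q := fun Z => by
    rw [hMf, (cellMembers_finite M p q).mem_toFinset]
  set Ef : Finset (Set α) := (eqMembers_finite M p q S).toFinset with hEf
  have hmemE : ∀ Z, Z ∈ Ef ↔ Z ∈ cellMembers M p q ∧ Z ⊆ S := fun Z => by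
    rw [hEf, (eqMembers_finite M p q S).mem_toFinset]
    rfl
  set Θ : ℚ := ∑ Z' ∈ Ef, tiltTheta M q τ Z' with hΘ
  have hw : ∀ Z ∈ Mf, tiltWeight M p q τ Z S = if Z ⊆ S then tiltTheta M q τ Z / Θ else 0 := by
    intro Z hZ
    rw [hmemM] at hZ
    unfold tiltWeight
    by_cases hZS : Z ⊆ S
    · rw [if_pos ⟨hZ, hZS, hS⟩, if_pos hZS]
    · rw [if_neg (fun hc => hZS hc.2.1), if_neg hZS]
  rw [Finset.sum_congr rfl hw, Finset.sum_ite, Finset.sum_const_zero, add_zero]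
  have hfilter : Mf.filter (fun Z => Z ⊆ S) = Ef := by
    ext Z
    rw [Finset.mem_filter, hmemM, hmemE]
  rw [hfilter]
  by_cases hE : Ef = ∅
  · rw [hE, Finset.sum_empty]
    exact zero_le_one
  · have hΘpos : 0 < Θ := by
      obtain ⟨Z₀, hZ₀⟩ := Finset.nonempty_iff_ne_empty.2 hE
      rw [hΘ]
      exact Finset.sum_pos (fun Z' _ => tiltTheta_pos M q hτ Z') ⟨Z₀, hZ₀⟩
    rw [← Finset.sum_div, ← hΘ, div_self hΘpos.ne']

/-- **The tilted receipt condition** (a `Prop`, NOT asserted): every member receives at least `Φ(p,q)` under the `d`-tilted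
split with parameter `τ`.  The candidate of record for `k ≥ 3` (`τ = 1`). -/
def TiltRecv (p q : ℕ) (τ : ℚ) : Prop :=
  ∀ Z ∈ cellMembers M p q, phiK p q ≤ ∑ S ∈ (cellY_finite M p q).toFinset, tiltWeight M p q τ Z S

/-- **THE TRANSFER**: for `τ ≥ 0`, `TiltRecv M p q τ` gives the UP-Hall condition for every family of members (through night-1's
`hallUp_of_fracMatching`; no tight-layer hypothesis is needed for the loads). -/
theorem hallUp_of_tilt (p q : ℕ) {τ : ℚ} (hτ : 0 ≤ τ) (h : TiltRecv M p q τ) (𝒜 : Set (Set α))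
    (h𝒜 : 𝒜 ⊆ cellMembers M p q) :
    phiK p q * (𝒜.ncard : ℚ) ≤ ((upNbhd M p q 𝒜).ncard : ℚ) :=
  hallUp_of_fracMatching M p q (tiltWeight M p q τ) (tiltWeight_nonneg M p q hτ) (subset_of_tiltWeight_ne_zero M p q τ)
    (fun _ hZ => h _ hZ) (fun _ hS => tiltWeight_load_le_one M p q hτ hS) 𝒜 h𝒜

end PercRepro
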